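import Literature.NumberTheory.Transcendental.RoySmallValueAnalytic
import Literature.NumberTheory.Transcendental.RoySmallValueEstimatesHomogenizationProofs
import Literature.NumberTheory.Transcendental.RoyCriterionProofs
import HarnessLib

/-!
# Roy's small value estimate for `𝔾ₐ × 𝔾ₘ` — the dictionary `𝒟₁ ↔ 𝒟` between `ℤ[X₁, X₂]` and forms

Topic `Literature/NumberTheory/Transcendental`. Part of the formalisation of the proof of Roy 2013,
Theorem 1.1 (named fact `roy2013_thm_1_1`, `RoySmallValueEstimates.lean`). Source: D. Roy,
*A small value estimate for `𝔾ₐ × 𝔾ₘ`*, Mathematika 59 (2013) 333–363 = arXiv:1301.0663, §3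
(p. 8 of the arXiv text) and §7, Step 1 (p. 18):

> [...] the derivation `𝒟 = X₀ ∂/∂X₁ + X₂ ∂/∂X₂` [is] the homogeneous version of the derivation
> `𝒟₁ = ∂/∂X₁ + X₂ ∂/∂X₂`: `𝒟P(1, X₁, X₂) = 𝒟₁(P(1, X₁, X₂))`.
> [...] `|𝒟ⁱQ(1, γ)| = |𝒟₁^{i+j}(X₁^a X₂^{−b} P_D(X₁, X₂))|_{X₁=ξ, X₂=η}` [...]

Theorem 1.1's hypothesis is stated with `𝒟₁ = royD` on `ℤ[X₁, X₂]` (`RoyCriterion.lean`), the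
machinery of §§3–6 with `𝒟 = homD` on `ℂ[X₀, X₁, X₂]`. This file proves the dictionary at the
level of VALUES: for `F ∈ ℤ[X₁, X₂]` with `deg F ≤ N` and its integer homogenisation
`F̃ = homogInt N F` (`NguyenRoy.homogInt` of the tree),
`𝒟ᵗF̃(1, ξ, η) = (𝒟₁ᵗF)(ξ, η)` for all `t` (`aeval_iterate_homD_homogInt`), through the generating
function `z ↦ F(ξ + z, η e^z)` (`expEval2`), whose `t`-th derivative at `0` is both sides
(`iteratedDeriv_expEval2_zero`, and the tree's `iteratedDeriv_expEvalH_zero`). Everything is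
proved; one auxiliary definition (`expEval2`); no named facts.

## References

* [Roy2013] D. Roy, *A small value estimate for 𝔾ₐ × 𝔾ₘ*, Mathematika 59 (2013), 333–363
  (arXiv:1301.0663), §3 (the derivations `𝒟`, `𝒟₁`) and §7, Step 1.
-/

noncomputable section

open MvPolynomial Complex

namespace Literature.NumberTheory.Transcendental

namespace Roy2013

/-! ### The generating function `z ↦ F(ξ + z, η e^z)` -/

/-- `f_F(z) = F(ξ + z, η e^z)` for `F ∈ ℤ[X₁, X₂]`. [cite: Roy2013, §7, Step 1 (values
`𝒟₁ᵗF(ξ, η)`); cf. §4, proof of Proposition 4.2] -/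
def expEval2 (F : MvPolynomial (Fin 2) ℤ) (ξ η z : ℂ) : ℂ := aeval ![ξ + z, η * cexp z] F

/-- `f_F(0) = F(ξ, η)`. [folklore] -/
theorem expEval2_zero (F : MvPolynomial (Fin 2) ℤ) (ξ η : ℂ) : expEval2 F ξ η 0 = aeval ![ξ, η] F := by
  simp only [expEval2, add_zero, Complex.exp_zero, mul_one]

/-- **`f_F' = f_{𝒟₁F}`.** [cite: Roy2013, §3 ("`𝒟₁ = ∂/∂X₁ + X₂∂/∂X₂`")] -/
theorem hasDerivAt_expEval2 (F : MvPolynomial (Fin 2) ℤ) (ξ η z : ℂ) :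
    HasDerivAt (expEval2 F ξ η) (expEval2 (royD F) ξ η z) z := by
  induction F using MvPolynomial.induction_on with
  | C a =>
    have h1 : expEval2 (C a) ξ η = fun _ => (a : ℂ) := by ext w; simp [expEval2]
    rw [h1, royD_C, expEval2, map_zero]
    exact hasDerivAt_const _ _
  | add p q hp hq =>
    have h1 : expEval2 (p + q) ξ η = fun w => expEval2 p ξ η w + expEval2 q ξ η w := by
      ext w; simp [expEval2]
    rw [h1, royD_add, expEval2, map_add]
    exact hp.add hq
  | mul_X p i hp =>
    have h1 : expEval2 (p * X i) ξ η =
        fun w => expEval2 p ξ η w * (![ξ + w, η * cexp w] : Fin 2 → ℂ) i := by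
      ext w; simp only [expEval2, map_mul, aeval_X]
    have h2 : expEval2 (royD (p * X i)) ξ η z =
        expEval2 (royD p) ξ η z * (![ξ + z, η * cexp z] : Fin 2 → ℂ) i +
          expEval2 p ξ η z * expEval2 (royD (X i)) ξ η z := by
      unfold expEval2
      rw [royD_mul, map_add, map_mul, map_mul, aeval_X]
    rw [h1, h2]
    fin_cases i
    · change HasDerivAt (fun w => expEval2 p ξ η w * (ξ + w))
        (expEval2 (royD p) ξ η z * (ξ + z) + expEval2 p ξ η z * expEval2 (royD (X 0)) ξ η z) z
      have e : expEval2 (royD (X 0)) ξ η z = 1 := by rw [royD_X_zero]; simp [expEval2]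
      rw [e]
      exact hp.mul ((hasDerivAt_id z).const_add ξ)
    · change HasDerivAt (fun w => expEval2 p ξ η w * (η * cexp w))
        (expEval2 (royD p) ξ η z * (η * cexp z) + expEval2 p ξ η z * expEval2 (royD (X 1)) ξ η z) z
      have e : expEval2 (royD (X 1)) ξ η z = η * cexp z := by
        rw [royD_X_one]; simp [expEval2]
      rw [e]
      exact hp.mul ((Complex.hasDerivAt_exp z).const_mul η)

/-- `(f_F)' = f_{𝒟₁F}`. [folklore] -/
theorem deriv_expEval2 (F : MvPolynomial (Fin 2) ℤ) (ξ η : ℂ) :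
    deriv (expEval2 F ξ η) = expEval2 (royD F) ξ η := by
  ext z; exact (hasDerivAt_expEval2 F ξ η z).deriv

/-- `f_F` is entire. [folklore] -/
theorem differentiable_expEval2 (F : MvPolynomial (Fin 2) ℤ) (ξ η : ℂ) :
    Differentiable ℂ (expEval2 F ξ η) := fun z => (hasDerivAt_expEval2 F ξ η z).differentiableAt

/-- `f_F^{(t)} = f_{𝒟₁ᵗF}`. [folklore] -/
theorem iteratedDeriv_expEval2 (t : ℕ) (F : MvPolynomial (Fin 2) ℤ) (ξ η : ℂ) :
    iteratedDeriv t (expEval2 F ξ η) = expEval2 (royD^[t] F) ξ η := by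
  induction t generalizing F with
  | zero => simp
  | succ t ih => rw [iteratedDeriv_succ', deriv_expEval2, ih, Function.iterate_succ_apply]

/-- **`f_F^{(t)}(0) = (𝒟₁ᵗF)(ξ, η)`.** [cite: Roy2013, §7, Step 1] -/
theorem iteratedDeriv_expEval2_zero (t : ℕ) (F : MvPolynomial (Fin 2) ℤ) (ξ η : ℂ) :
    iteratedDeriv t (expEval2 F ξ η) 0 = aeval ![ξ, η] (royD^[t] F) := by
  rw [iteratedDeriv_expEval2, expEval2_zero]

/-! ### Homogenisation and the two derivations -/

/-- The complexification of the integer homogenisation. [cite: Roy2013, §7, Step 1 (`P̃_D`)] -/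
abbrev homogC (N : ℕ) (F : MvPolynomial (Fin 2) ℤ) : CX :=
  map (Int.castRingHom ℂ) (NguyenRoy.homogInt N F)

/-- Values on the chart `X₀ = 1`: `F̃(1, x, y) = F(x, y)`. [folklore] -/
theorem aeval_one_homogC (N : ℕ) (F : MvPolynomial (Fin 2) ℤ) (x y : ℂ) :
    aeval ![1, x, y] (homogC N F) = aeval ![x, y] F := by
  rw [homogC, ← algebraMap_int_eq, aeval_map_algebraMap,
    NguyenRoy.aeval_homogInt N F ![1, x, y] (by simp)]
  congr 1

/-- The generating functions agree: `F̃(1, ξ + z, η e^z) = F(ξ + z, η e^z)`. [folklore] -/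
theorem expEvalH_homogC (N : ℕ) (F : MvPolynomial (Fin 2) ℤ) (ξ η : ℂ) :
    expEvalH (homogC N F) ξ η = expEval2 F ξ η := by
  funext z
  rw [expEvalH, aeval_one_homogC]
  rfl

/-- **The dictionary `𝒟 ↔ 𝒟₁` on values**: `𝒟ᵗF̃(1, ξ, η) = (𝒟₁ᵗF)(ξ, η)` for the integer
homogenisation `F̃` (in any degree `N`) of `F ∈ ℤ[X₁, X₂]`.
[cite: Roy2013, §3 ("`𝒟P(1, X₁, X₂) = 𝒟₁(P(1, X₁, X₂))`") and §7, Step 1] -/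
theorem aeval_iterate_homD_homogC (N : ℕ) (F : MvPolynomial (Fin 2) ℤ) (ξ η : ℂ) (t : ℕ) :
    aeval ![1, ξ, η] (homD^[t] (homogC N F)) = aeval ![ξ, η] (royD^[t] F) := by
  rw [← iteratedDeriv_expEvalH_zero, expEvalH_homogC, iteratedDeriv_expEval2_zero]

end Roy2013

end Literature.NumberTheory.Transcendental
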